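import Summits.BirchSwinnertonDyer.BirchSwinnertonDyer.Theorems.ManinLocalTwoThreeDyadicUntwistTransport
import Summits.BirchSwinnertonDyer.Rank1Residual.ManinAdditive.HalfTranslateTwistStep
import Literature.NumberTheory.EllipticCurves.QuadraticTwistNegOneMinimalDiscriminantProofs
import HarnessLib

/-!
# Route `ManinLocalTwoThree` (cell `bsd-f2-manin`), crux C2 `ManinOddAtFour` (stmt-BirchSwinnertonDyer-22967):
# transport of `p ∤ c` UP an ADDITIVE → ADDITIVE dyadic twist from LOWER level

The landed dyadic transports of this route (`ManinLocalTwoThreeDyadicUntwistTransport`, Stevens `η = 1, 2`)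
need the untwisted class to be SEMISTABLE at `2` (`4 ∤ N(W')`). Here the lower class is itself ADDITIVE at
`2`: `W ∼ A ⊗ ℚ(√d)`, `d ∈ {−1, ±2}`, `4 ∣ N(A)`, `N(A) ∣ N(W)`, `(4|d|)² ∣ N(W)`. Tools, all from the tree:
* §1 HALF-TRANSLATE `{∞, r + ½}_f = −{∞, r}_f` at `4 ∣ N` (the tree's S-an-9a `modularSymbol_add_half_eq_neg`
  needs `4² ∣ N`; we apply it to the LIFT of `f` to level `4N` by the trivial character mod `1`, which has the
  same `q`-expansion and the same modular symbols — `charTwist` / Birch's lemma with one term);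
* §2 the engine `c(D) ∣ r · c(D')`: `f_W = f_A ⊗ χ` (both additive ⇒ even coefficients vanish), the EXACT
  twist step `(g(χ)/2) Λ(f_A ⊗ χ) ⊆ Λ(f_A)` (T-an-7 §16 `half_gaussSum_mul_mem_periodLattice_of_mem_charTwist`),
  the Néron lattice of the minimal model `C` of `A ⊗ d`, `Λ_C = ± r (g/2)⁻¹ Λ_A` when `r¹²Δ(C) = d⁶Δ(A)`
  (§17 `neronLattice_mem_iff_of_twist_of_sq_eq`), and the `Γ₀` engine `maninConstant_dvd_mul_of_twistStep`;
* §3 `χ₋₄`: `r = 1` ALWAYS, by the discharged Connell–Pal lemma `Δ(C) = Δ(A)` (both additive at `2`) ⟹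
  `maninLocalTwoThree_not_dvd_maninConstant_of_additiveUntwist_negOne`: `p ∤ c` on the class of `A`
  ⟹ `p ∤ c(D)` (class-level, via the optimal datum of the class of `A`);
* §4 `χ±8`: `r = 1` iff the discriminants are ALIGNED, `Δ(C) = d⁶Δ(A)` (`v₂Δ_min` goes UP by `6`; the only
  alternative is DOWN by `6`, `padicValInt_minimalDiscriminantInt_twoTwist_le`, where one gets `c(D) ∣ 2c(D')`).
Effect on the C2 core (cell census TWISTCENSUS2 × this seat's join, optimal classes with `4 ∣ N ≤ 5·10⁵`):
of the 700 867 dyadically twist-minimal classes, ALL 129 623 with `v₂(N) = 4` are `χ₋₄`-lifts of additive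
classes with `v₂(N) ∈ {2, 3}`, and 90 667 of the 104 344 with `v₂(N) = 6` are aligned `χ±8`-lifts of
additive classes with `v₂(N) ≤ 5`; the globally-twist-minimal core `H₂` (487 948, seat p1) shrinks to
331 547 classes with `v₂(N) ∈ {2, 3, 5, 6, 7, 8}` (`v₂ = 6`: only the 10 375 misaligned lifts remain).
The reduction of the crux BY NAME is the sequel `ManinLocalTwoThreeManinOddAtFourDyadicLevelMinimal.lean`.
Nothing here proves BSD or Manin's conjecture. Seat bsd-line-manin23-p2 (gen 2).

References: [Stevens1989] Lemma (5.4); [Pal2012] Prop. 2.4, Lemma 3.1; [Manin1972] §1.2; [Cremona1997]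
§2.8; [Shimura1971] Prop. 3.64; [SilvermanATAEC1994] Cor. IV.9.1.
-/

set_option autoImplicit false
set_option linter.dupNamespace false

noncomputable section

open scoped MatrixGroups ModularForm Classical NumberField

namespace Summit.BirchSwinnertonDyer.BirchSwinnertonDyer.Theorems

open CongruenceSubgroup WeierstrassCurve IsDedekindDomain IsDedekindDomain.HeightOneSpectrum
  Rat.HeightOneSpectrum Literature.NumberTheory.Automorphic
  Literature.NumberTheory.EllipticCurves Literature.NumberTheory.EllipticCurves.ModularForms
  Summit.BirchSwinnertonDyer.Rank1Residual.ManinAdditive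

/-! ## §1 Level lift by the trivial character and HALF-TRANSLATE at `4 ∣ N` -/

/-- The trivial Dirichlet character mod `1` is quadratic (all its values are `1`). [elementary] -/
theorem maninLocalTwoThree_isQuadratic_one_level_one :
    (1 : DirichletCharacter ℂ 1).IsQuadratic :=
  fun a ↦ Or.inr (Or.inl (MulChar.one_apply (isUnit_of_subsingleton a)))

/-- The character sum of Birch's lemma for the trivial character mod `1` is the single symbol
`{∞, x}_f` (`sh 0 = 0`). [elementary] -/
theorem maninLocalTwoThree_sum_one_level_one_modularSymbol {N : ℕ} [NeZero N]
    (f : CuspForm (Gamma0 N) 2) (x : ℚ) :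
    ∑ u : ZMod 1, (1 : DirichletCharacter ℂ 1) u * modularSymbol f (x + twistShift u) =
      modularSymbol f x := by
  show (∑ u : Fin 1, (1 : DirichletCharacter ℂ 1) u * modularSymbol f (x + twistShift (m := 1) u)) = _
  rw [Fin.sum_univ_one, MulChar.one_apply (isUnit_of_subsingleton _), one_mul]
  have h0 : twistShift (m := 1) 0 = 0 := by
    rw [twistShift, ZMod.val_zero]
    simp
  rw [show ((0 : Fin 1)) = (0 : ZMod 1) from rfl, h0, add_zero]

/-- The Gauss sum of the trivial character mod `1` is `1`. [elementary] -/
theorem maninLocalTwoThree_gaussSum_one_level_one :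
    gaussSum (1 : DirichletCharacter ℂ 1) (ZMod.stdAddChar (N := 1)) = 1 := by
  rw [gaussSum]
  show (∑ u : Fin 1, (1 : DirichletCharacter ℂ 1) u * (ZMod.stdAddChar (N := 1)) u) = 1
  rw [Fin.sum_univ_one, MulChar.one_apply (isUnit_of_subsingleton _), one_mul,
    show ((0 : Fin 1)) = (0 : ZMod 1) from rfl, AddChar.map_zero_eq_one]

/-- **Level lift.** The twist of `f ∈ S₂(Γ₀(N))` by the trivial character mod `1` to any level `L`
with `N ∣ L` has the same modular symbols as `f` (Birch's lemma `modularSymbol_charTwist` with one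
term). [cite: Shimura1971, Prop. 3.64] -/
theorem maninLocalTwoThree_modularSymbol_charTwist_one {N : ℕ} [NeZero N] (L : ℕ) [NeZero L]
    (hN : N ∣ L) (hm : 1 ^ 2 ∣ L) (f : CuspForm (Gamma0 N) 2) (r : ℚ) :
    modularSymbol (charTwist L hN hm maninLocalTwoThree_isQuadratic_one_level_one f) r =
      modularSymbol f r := by
  rw [modularSymbol_charTwist L hN hm maninLocalTwoThree_isQuadratic_one_level_one f r,
    maninLocalTwoThree_sum_one_level_one_modularSymbol, maninLocalTwoThree_gaussSum_one_level_one,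
    inv_one, one_mul]

/-- **HALF-TRANSLATE at `4 ∣ N`.** For `f ∈ S₂(Γ₀(N))` with `4 ∣ N` whose even `q`-expansion
coefficients vanish (every newform of an elliptic curve additive at `2`), `{∞, r + ½}_f = −{∞, r}_f`.
The tree's `modularSymbol_add_half_eq_neg` (S-an-9a) needs `4² ∣ N`; here it is applied to the lift of
`f` to level `4N` by the trivial character mod `1` (same `q`-expansion, same modular symbols).
[cite: Manin1972, §1.2] [cite: Cremona1997, §2.8] -/
theorem maninLocalTwoThree_modularSymbol_add_half_eq_neg_of_four_dvd {N : ℕ} [NeZero N]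
    (f : CuspForm (Gamma0 N) 2) (h4 : 4 ∣ N) (heven : ∀ n : ℕ, 2 ∣ n → cuspCoeff f n = 0) (r : ℚ) :
    modularSymbol f (r + 1 / 2) = -modularSymbol f r := by
  haveI : NeZero (4 * N) := ⟨mul_ne_zero four_ne_zero (NeZero.ne N)⟩
  have hN : N ∣ 4 * N := dvd_mul_left N 4
  have hm : 1 ^ 2 ∣ 4 * N := by rw [one_pow]; exact one_dvd _
  have h16 : 4 ^ 2 ∣ 4 * N := by rw [pow_two]; exact Nat.mul_dvd_mul_left 4 h4
  have heven' : ∀ n : ℕ, 2 ∣ n →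
      cuspCoeff (charTwist (4 * N) hN hm maninLocalTwoThree_isQuadratic_one_level_one f) n = 0 := by
    intro n hn
    rw [cuspCoeff_charTwist (4 * N) hN hm maninLocalTwoThree_isQuadratic_one_level_one
      DirichletCharacter.isPrimitive_one_level_one, heven n hn, mul_zero]
  have key := modularSymbol_add_half_eq_neg
    (charTwist (4 * N) hN hm maninLocalTwoThree_isQuadratic_one_level_one f) h16 heven' r
  rwa [maninLocalTwoThree_modularSymbol_charTwist_one, maninLocalTwoThree_modularSymbol_charTwist_one]
    at key

/-! ## §2 The engine: `c(D) ∣ r · c(D')` along an additive → additive dyadic twist `W ∼ A ⊗ χ` -/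

/-- **Additive → additive dyadic twist engine (generic character).** `W` globally minimal with a
lattice-optimal `X₀(N)`-datum `D`, additive at `2`; `A` globally minimal, additive at `2`, with ANY
`X₀(N')`-datum `D'`, `4 ∣ N'`, `N' ∣ N`, `m² ∣ N`; `χ` a primitive quadratic character mod `m` killing the
even residues with `g(χ)² = 4d` and `aₙ(A ⊗ d) = χ(n) aₙ(A)` at odd `n`, whose Birch character sum collapses
pairwise under HALF-TRANSLATE (`hsumOf`, the tree's `sum_χ₄/χ₈/χ₈'_modularSymbol_of_half`);
`W ∼ A ⊗ ℚ(√d)`; `C = u • (A ⊗ d)` globally minimal with `r¹² Δ(C) = d⁶ Δ(A)`. Then `c(D) ∣ r · c(D')`.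
Chain: `f_D = f_{D'} ⊗ χ` (both curves additive at `2`, so all even coefficients vanish), the EXACT twist
step `(g(χ)/2) Λ(f_{D'} ⊗ χ) ⊆ Λ(f_{D'})` (`half_gaussSum_mul_mem_periodLattice_of_mem_charTwist`, fed by
HALF-TRANSLATE for `f_{D'}` at `4 ∣ N'`), the Néron lattice `Λ_C = ± r (g/2)⁻¹ Λ_A`
(`neronLattice_mem_iff_of_twist_of_sq_eq`) and the `Γ₀` engine `maninConstant_dvd_mul_of_twistStep`.
[cite: Stevens1989, Lemma (5.4) p. 97] [cite: Pal2012, Lemma 3.1] [cite: SilvermanATAEC1994, Cor. IV.9.1] -/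
theorem maninLocalTwoThree_maninConstant_dvd_mul_of_additiveTwist_of_char
    {W : WeierstrassCurve ℚ} [W.IsElliptic] [W.IsGloballyMinimal] {N : ℕ} [NeZero N]
    (D : ModularParametrizationData W N)
    (hopt : ∀ z ∈ D.L.lattice, ∃ w ∈ periodLattice D.f, z = D.c * w)
    {A : WeierstrassCurve ℚ} [A.IsElliptic] [A.IsGloballyMinimal] {N' : ℕ} [NeZero N']
    (D' : ModularParametrizationData A N')
    {d : ℤ} (hd : d ≠ 0)
    {m : ℕ} [NeZero m] {χ : DirichletCharacter ℂ m} (hχq : χ.IsQuadratic) (hχp : χ.IsPrimitive)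
    (hG : gaussSum χ (ZMod.stdAddChar (N := m)) ^ 2 = ((4 * d : ℤ) : ℂ))
    (hsumOf : (∀ x : ℚ, modularSymbol D'.f (x + 1 / 2) = -modularSymbol D'.f x) →
      ∀ x : ℚ, ∃ (u₁ u₂ : ZMod m) (ε : ℤ),
        ∑ v : ZMod m, χ v * modularSymbol D'.f (x + twistShift v) =
          2 * (modularSymbol D'.f (x + twistShift u₁) + ε * modularSymbol D'.f (x + twistShift u₂)))
    (hχodd : ∀ n : ℕ, ¬ 2 ∣ n →
      (((A.quadraticTwist (d : ℚ)).LFunction n : ℤ) : ℂ) = χ n * ((A.LFunction n : ℤ) : ℂ))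
    (hχeven : ∀ n : ℕ, 2 ∣ n → χ n = 0)
    (htw : IsIsogenous W (A.quadraticTwist (d : ℚ)))
    {C : WeierstrassCurve ℚ} [C.IsElliptic] [C.IsGloballyMinimal] (u : VariableChange ℚ)
    (hu : u • A.quadraticTwist (d : ℚ) = C) {r : ℤ} (hΔ : (r : ℚ) ^ 12 * C.Δ = (d : ℚ) ^ 6 * A.Δ)
    (hN'N : N' ∣ N) (hmN : m ^ 2 ∣ N) (h4N' : 4 ∣ N')
    (haddA : ¬ A.HasGoodReductionAtPrime 2 ∧ ¬ A.HasMultiplicativeReductionAtPrime 2)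
    (hadd : ¬ W.HasGoodReductionAtPrime 2 ∧ ¬ W.HasMultiplicativeReductionAtPrime 2) :
    D.c ∣ r * D'.c := by
  have hd0 : (d : ℚ) ≠ 0 := by exact_mod_cast hd
  haveI : (A.quadraticTwist (d : ℚ)).IsElliptic := A.isElliptic_quadraticTwist hd0
  set s : ℂ := gaussSum χ (ZMod.stdAddChar (N := m)) / 2 with hs
  have hG0 : gaussSum χ (ZMod.stdAddChar (N := m)) ≠ 0 :=
    gaussSum_stdAddChar_ne_zero_of_isPrimitive hχp
  have hs0 : s ≠ 0 := div_ne_zero hG0 two_ne_zero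
  have hs2 : s ^ 2 = ((d : ℚ) : ℂ) := by
    rw [hs, div_pow, hG]
    push_cast
    ring
  -- HALF-TRANSLATE for `f_{D'}`: the even coefficients of the newform of `A` vanish (`A` additive at `2`)
  have heven : ∀ n : ℕ, 2 ∣ n → cuspCoeff D'.f n = 0 := by
    intro n hn
    rw [D'.isNewformOf.2 n, A.LFunction_apply_eq_zero_of_not_good_of_not_mult 2 haddA.1 haddA.2 hn]
    simp
  have hhalf : ∀ x : ℚ, modularSymbol D'.f (x + 1 / 2) = -modularSymbol D'.f x :=
    maninLocalTwoThree_modularSymbol_add_half_eq_neg_of_four_dvd D'.f h4N' heven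
  -- the exact twist step `s · Λ(f_{D'} ⊗ χ) ⊆ Λ(f_{D'})`
  have hstep : ∀ w ∈ periodLattice (charTwist N hN'N hmN hχq D'.f), s * w ∈ periodLattice D'.f :=
    fun w hw ↦ half_gaussSum_mul_mem_periodLattice_of_mem_charTwist N hN'N hmN hχq hχp D'.f
      (hsumOf hhalf) hw
  -- the newform of `W` is the `χ`-twist of that of `A`
  have hLtw : W.LFunction = (A.quadraticTwist (d : ℚ)).LFunction :=
    LFunction_eq_of_isIsogenous_holds _ _ htw
  have hf : ∀ n : ℕ, cuspCoeff D.f n = χ n * cuspCoeff D'.f n := by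
    intro n
    rw [D.isNewformOf.2 n, D'.isNewformOf.2 n]
    by_cases h2n : 2 ∣ n
    · have h0 : W.LFunction n = 0 :=
        W.LFunction_apply_eq_zero_of_not_good_of_not_mult 2 hadd.1 hadd.2 h2n
      rw [h0, hχeven n h2n]
      simp
    · have hLn' : W.LFunction n = (A.quadraticTwist (d : ℚ)).LFunction n := by rw [hLtw]
      rw [hLn', hχodd n h2n]
  -- Néron lattice of the minimal model `C` of `A ⊗ d`: `z ∈ Λ_C ↔ s r⁻¹ z ∈ Λ_A`
  obtain ⟨LC, hC⟩ := exists_isNeronLatticeOf_holds (C.baseChange ℂ)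
  have hLC : ∀ z : ℂ, s * z ∈ D'.L.lattice → (r : ℂ) * z ∈ LC.lattice := by
    intro z hz
    rw [neronLattice_mem_iff_of_twist_of_sq_eq hd0 u hu hΔ hs2 D'.isNeronLattice hC]
    by_cases hr : (r : ℚ) = 0
    · have : ((r : ℚ) : ℂ) = 0 := by exact_mod_cast hr
      rw [show (r : ℂ) = ((r : ℚ) : ℂ) by push_cast; rfl, this, zero_mul, mul_zero, mul_zero]
      exact zero_mem _
    · have hrC : ((r : ℚ) : ℂ) ≠ 0 := by exact_mod_cast hr
      have e : s * ((((r : ℚ) : ℂ))⁻¹ * ((r : ℂ) * z)) = s * z := by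
        rw [show (r : ℂ) = ((r : ℚ) : ℂ) by push_cast; rfl]
        field_simp
      rw [e]
      exact hz
  exact maninConstant_dvd_mul_of_twistStep D' D hopt hχq hχp hN'N hmN hf s hstep hC r hLC

/-! ## §3 `χ₋₄`: transport of `p ∤ c` UP an additive `−1`-twist of lower level (unconditional clause) -/

/-- **Transport of `p ∤ c` along an ADDITIVE `χ₋₄`-untwist to lower level** (granted modularity `hnf`;
any prime `p`). `W` globally minimal with a lattice-optimal `X₀(N)`-datum `D`, `2⁴ ∣ N`; `A` globally
minimal, ADDITIVE at `2` (`2² ∣ N(A)`), `N(A) ∣ N`, and `W ∼ A ⊗ ℚ(√−1)`. If every lattice-optimal datum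
on the class of `A` has Manin constant prime to `p`, then `p ∤ D.maninConstant`. The divisibility behind
it is EXACT, `c(D) ∣ c(D')` for the optimal datum `D'` of the class of `A`: §2 with `χ = χ₄`
(`g(χ₄)/2 = i`), the Néron lattice clause `Δ(C) = Δ(A₁)` for the minimal model `C` of `A₁ ⊗ (−1)` being
the discharged Connell–Pal lemma (`connellPal_Δ_eq_of_negOne_twist_of_four_dvd_conductor_holds`: both
curves additive at `2`). New reach over the landed `…_of_dyadicUntwist_semistable` (which needs
`4 ∤ N(A)`): the lower class may itself be additive at `2` — every twist-minimal class with `v₂(N) = 4`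
is such a lift of a class with `v₂(N) ∈ {2, 3}` (cell census TWISTCENSUS2: 129 623 / 129 623, `N ≤ 5·10⁵`).
[cite: Stevens1989, Lemma (5.4) p. 97] [cite: Pal2012, Prop. 2.4 (Connell), Lemma 3.1] -/
theorem maninLocalTwoThree_not_dvd_maninConstant_of_additiveUntwist_negOne
    (hnf : exists_isNewformOf)
    {W : WeierstrassCurve ℚ} [W.IsElliptic] [W.IsGloballyMinimal] {N : ℕ} [NeZero N]
    (D : ModularParametrizationData W N)
    (hopt : ∀ z ∈ D.L.lattice, ∃ w ∈ periodLattice D.f, z = D.c * w) (h16 : 2 ^ 4 ∣ N)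
    {A : WeierstrassCurve ℚ} [A.IsElliptic] [A.IsGloballyMinimal]
    (htw : IsIsogenous W (A.quadraticTwist ((-1 : ℤ) : ℚ)))
    (h4A : 2 ^ 2 ∣ A.conductorNorm ℤ) (hAN : A.conductorNorm ℤ ∣ N) {p : ℤ}
    (hp : ∀ (W₁ : WeierstrassCurve ℚ) [W₁.IsElliptic] [W₁.IsGloballyMinimal] {N₁ : ℕ} [NeZero N₁]
      (D₁ : ModularParametrizationData W₁ N₁), IsIsogenous A W₁ →
      (∀ z ∈ D₁.L.lattice, ∃ w ∈ periodLattice D₁.f, z = D₁.c * w) → ¬ p ∣ D₁.maninConstant) :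
    ¬ p ∣ D.maninConstant := by
  haveI : Fact (Nat.Prime 2) := ⟨Nat.prime_two⟩
  have hd0 : ((-1 : ℤ) : ℚ) ≠ 0 := by norm_num
  haveI : (A.quadraticTwist ((-1 : ℤ) : ℚ)).IsElliptic := A.isElliptic_quadraticTwist hd0
  haveI : NeZero (A.conductorNorm ℤ) := ⟨(conductorNorm_pos_holds A).ne'⟩
  have hmod : nonempty_modularParametrizationData :=
    nonempty_modularParametrizationData_of_exists_isNewformOf hnf
      IsNewformOf.exists_maninConstant_ne_zero_holds
  -- `W` is additive at `2`
  have hN : N = W.conductorNorm ℤ :=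
    IsNewformOf.level_eq_conductorNorm_of_exists_isNewformOf hnf D.isNewformOf
  have h4 : 2 ^ 2 ∣ N := dvd_trans (by norm_num) h16
  have hadd : ¬ W.HasGoodReductionAtPrime 2 ∧ ¬ W.HasMultiplicativeReductionAtPrime 2 :=
    not_good_and_not_mult_of_sq_dvd_conductorNorm W (hN ▸ h4)
  -- the optimal datum `D'` of the class of `A`
  obtain ⟨f', hf'⟩ := hnf A
  obtain ⟨A₁, hE₁, hM₁, D', hD'f, hiso', hmin⟩ :=
    exists_optimal_modularParametrizationData_of_isNewformOf' (A.conductorNorm ℤ) A rfl hf'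
  haveI := hE₁
  haveI := hM₁
  have hopt' : ∀ z ∈ D'.L.lattice, ∃ w ∈ periodLattice D'.f, z = D'.c * w :=
    D'.latticeEq_of_forall_modularDegree_le fun W₂ _ D₂ h2 ↦ hmin W₂ D₂ (h2.trans hD'f)
  have hA₁ : A.conductorNorm ℤ = A₁.conductorNorm ℤ :=
    IsNewformOf.level_eq_conductorNorm_of_exists_isNewformOf hnf D'.isNewformOf
  have haddA₁ : ¬ A₁.HasGoodReductionAtPrime 2 ∧ ¬ A₁.HasMultiplicativeReductionAtPrime 2 :=
    not_good_and_not_mult_of_sq_dvd_conductorNorm A₁ (hA₁ ▸ h4A)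
  -- the minimal model `C` of `A₁ ⊗ (−1)` lies in the class of `W`; Connell–Pal: `Δ(C) = Δ(A₁)`
  haveI : (A₁.quadraticTwist ((-1 : ℤ) : ℚ)).IsElliptic := A₁.isElliptic_quadraticTwist hd0
  obtain ⟨vC, hvC⟩ := hasGlobalMinimalModel_rat_holds (A₁.quadraticTwist ((-1 : ℤ) : ℚ))
  haveI := hvC
  have htw₁ : IsIsogenous W (A₁.quadraticTwist ((-1 : ℤ) : ℚ)) :=
    htw.trans' (hiso'.quadraticTwist hd0)
  have hCW : IsIsogenous (vC • A₁.quadraticTwist ((-1 : ℤ) : ℚ)) W :=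
    ((isIsogenous_of_smul (A₁.quadraticTwist ((-1 : ℤ) : ℚ)) vC).trans'
      (IsIsogenous.symm_of_isElliptic htw₁))
  have h4C : 2 ^ 2 ∣ (vC • A₁.quadraticTwist ((-1 : ℤ) : ℚ)).conductorNorm ℤ := by
    rw [conductorNorm_eq_of_isIsogenous_of_modularity hmod _ _ hCW, ← hN]
    exact h4
  have hΔC : (vC • A₁.quadraticTwist ((-1 : ℤ) : ℚ)).Δ = A₁.Δ :=
    connellPal_Δ_eq_of_negOne_twist_of_four_dvd_conductor_holds A₁ _ vC (hA₁ ▸ h4A) h4C rfl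
  have hΔ : ((1 : ℤ) : ℚ) ^ 12 * (vC • A₁.quadraticTwist ((-1 : ℤ) : ℚ)).Δ =
      (((-1 : ℤ) : ℚ)) ^ 6 * A₁.Δ := by
    rw [hΔC]; norm_num
  -- the engine with `χ₄`, `r = 1`
  have hdvd : D.c ∣ 1 * D'.c :=
    maninLocalTwoThree_maninConstant_dvd_mul_of_additiveTwist_of_char D hopt D' (d := -1)
      (by norm_num) isQuadratic_χ₄_ringHomComp isPrimitive_χ₄_ringHomComp
      (by rw [gaussSum_χ₄_ringHomComp_sq]; norm_num)
      (fun hhalf x ↦ ⟨1, 3, 0, sum_χ₄_modularSymbol_of_half D'.f hhalf x⟩)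
      (fun n hn ↦ by
        rw [show ((-1 : ℤ) : ℚ) = -1 by norm_num, A₁.LFunction_quadraticTwist_neg_one_apply_of_odd hn,
          Int.cast_mul, χ₄_ringHomComp_apply_natCast])
      (fun n hn ↦ by
        rw [χ₄_ringHomComp_apply_natCast, ZMod.χ₄_nat_eq_if_mod_four, if_pos (Nat.mod_eq_zero_of_dvd hn)]
        simp)
      htw₁ vC rfl hΔ (hA₁ ▸ hAN) (by simpa using h16)
      (by simpa using h4A) haddA₁ hadd
  rw [one_mul] at hdvd
  have hD' : ¬ p ∣ D'.maninConstant := hp A₁ D' hiso' hopt'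
  exact fun h ↦ hD' (h.trans hdvd)

/-! ## §4 `χ±8`: transport UP an additive `±2`-twist of lower level with ALIGNED discriminants -/

/-- **Exact divisibility `c(D) ∣ c(D')` along an ADDITIVE `χ±8`-twist with aligned discriminants**
(granted modularity `hnf`). `W` globally minimal with a lattice-optimal `X₀(N)`-datum `D`, `2⁶ ∣ N`;
`A` globally minimal, additive at `2`, `N(A) ∣ N`, with ANY `X₀(N')`-datum `D'`; `W ∼ A ⊗ ℚ(√d)`,
`d = ±2`; and the minimal model `C = u • (A ⊗ d)` satisfies `Δ(C) = d⁶ Δ(A)` (ALIGNED: `v₂` of the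
minimal discriminant goes UP by `6` along the twist — by the landed
`padicValInt_minimalDiscriminantInt_twoTwist_le` the only alternative is DOWN by `6`, where the chain
only gives `c(D) ∣ 2 c(D')`). Then `c(D) ∣ c(D')`: §2 with `χ = χ₈ / χ₈′` (`g/2 = √2 / i√2`) and `r = 1`.
[cite: Stevens1989, Lemma (5.4) p. 97] [cite: Pal2012, Prop. 2.4 (clause d ≡ 2 mod 4), Lemma 3.1] -/
theorem maninLocalTwoThree_maninConstant_dvd_of_additiveTwist_two_aligned
    (hnf : exists_isNewformOf)
    {W : WeierstrassCurve ℚ} [W.IsElliptic] [W.IsGloballyMinimal] {N : ℕ} [NeZero N]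
    (D : ModularParametrizationData W N)
    (hopt : ∀ z ∈ D.L.lattice, ∃ w ∈ periodLattice D.f, z = D.c * w) (h64 : 2 ^ 6 ∣ N)
    {d : ℤ} (hd : d = 2 ∨ d = -2)
    {A : WeierstrassCurve ℚ} [A.IsElliptic] [A.IsGloballyMinimal] {N' : ℕ} [NeZero N']
    (D' : ModularParametrizationData A N')
    (htw : IsIsogenous W (A.quadraticTwist (d : ℚ)))
    (h4A : 2 ^ 2 ∣ A.conductorNorm ℤ) (hAN : A.conductorNorm ℤ ∣ N)
    {C : WeierstrassCurve ℚ} [C.IsElliptic] [C.IsGloballyMinimal] (u : VariableChange ℚ)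
    (hu : u • A.quadraticTwist (d : ℚ) = C) (hΔ : C.Δ = (d : ℚ) ^ 6 * A.Δ) :
    D.c ∣ D'.c := by
  haveI : Fact (Nat.Prime 2) := ⟨Nat.prime_two⟩
  have hdZ : d ≠ 0 := by rcases hd with rfl | rfl <;> norm_num
  -- `W`, `A` additive at `2`; the level of `D'` is `N(A)`
  have hN : N = W.conductorNorm ℤ :=
    IsNewformOf.level_eq_conductorNorm_of_exists_isNewformOf hnf D.isNewformOf
  have h4 : 2 ^ 2 ∣ N := dvd_trans (by norm_num) h64
  have hadd : ¬ W.HasGoodReductionAtPrime 2 ∧ ¬ W.HasMultiplicativeReductionAtPrime 2 :=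
    not_good_and_not_mult_of_sq_dvd_conductorNorm W (hN ▸ h4)
  have hN' : N' = A.conductorNorm ℤ :=
    IsNewformOf.level_eq_conductorNorm_of_exists_isNewformOf hnf D'.isNewformOf
  have haddA : ¬ A.HasGoodReductionAtPrime 2 ∧ ¬ A.HasMultiplicativeReductionAtPrime 2 :=
    not_good_and_not_mult_of_sq_dvd_conductorNorm A h4A
  have hΔ' : ((1 : ℤ) : ℚ) ^ 12 * C.Δ = (d : ℚ) ^ 6 * A.Δ := by rw [hΔ]; norm_num
  have h4N' : 4 ∣ N' := by rw [hN']; simpa using h4A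
  have hmN : 8 ^ 2 ∣ N := by simpa using h64
  have hdvd : D.c ∣ 1 * D'.c := by
    rcases hd with rfl | rfl
    · exact maninLocalTwoThree_maninConstant_dvd_mul_of_additiveTwist_of_char D hopt D' hdZ
        isQuadratic_χ₈_ringHomComp isPrimitive_χ₈_ringHomComp
        (by rw [gaussSum_χ₈_ringHomComp_sq]; norm_num)
        (fun hhalf x ↦ ⟨1, 3, -1, sum_χ₈_modularSymbol_of_half D'.f hhalf x⟩)
        (fun n hn ↦ by
          rw [show ((2 : ℤ) : ℚ) = 2 by norm_num, A.LFunction_quadraticTwist_two_apply_of_odd hn,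
            Int.cast_mul, χ₈_ringHomComp_apply_natCast])
        (fun n hn ↦ by
          rw [χ₈_ringHomComp_apply_natCast, ZMod.χ₈_nat_eq_if_mod_eight,
            if_pos (Nat.mod_eq_zero_of_dvd hn)]
          simp)
        htw u hu hΔ' (hN' ▸ hAN) hmN h4N' haddA hadd
    · exact maninLocalTwoThree_maninConstant_dvd_mul_of_additiveTwist_of_char D hopt D' hdZ
        isQuadratic_χ₈'_ringHomComp isPrimitive_χ₈'_ringHomComp
        (by rw [gaussSum_χ₈'_ringHomComp_sq]; norm_num)
        (fun hhalf x ↦ ⟨1, 3, 1, sum_χ₈'_modularSymbol_of_half D'.f hhalf x⟩)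
        (fun n hn ↦ by
          rw [show ((-2 : ℤ) : ℚ) = -2 by norm_num, A.LFunction_quadraticTwist_neg_two_apply_of_odd hn,
            Int.cast_mul, χ₈'_ringHomComp_apply_natCast])
        (fun n hn ↦ by
          rw [χ₈'_ringHomComp_apply_natCast, ZMod.χ₈'_nat_eq_if_mod_eight,
            if_pos (Nat.mod_eq_zero_of_dvd hn)]
          simp)
        htw u hu hΔ' (hN' ▸ hAN) hmN h4N' haddA hadd
  rwa [one_mul] at hdvd

/-- **Transport of `p ∤ c` UP an aligned additive `±2`-twist** (any prime `p`; granted modularity): in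
the situation of `maninLocalTwoThree_maninConstant_dvd_of_additiveTwist_two_aligned`, `p ∤ c(D')`
implies `p ∤ c(D)`. [cite: Stevens1989, Lemma (5.4) p. 97] [cite: Pal2012, Lemma 3.1] -/
theorem maninLocalTwoThree_not_dvd_maninConstant_of_additiveUntwist_two_aligned
    (hnf : exists_isNewformOf)
    {W : WeierstrassCurve ℚ} [W.IsElliptic] [W.IsGloballyMinimal] {N : ℕ} [NeZero N]
    (D : ModularParametrizationData W N)
    (hopt : ∀ z ∈ D.L.lattice, ∃ w ∈ periodLattice D.f, z = D.c * w) (h64 : 2 ^ 6 ∣ N)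
    {d : ℤ} (hd : d = 2 ∨ d = -2)
    {A : WeierstrassCurve ℚ} [A.IsElliptic] [A.IsGloballyMinimal] {N' : ℕ} [NeZero N']
    (D' : ModularParametrizationData A N')
    (htw : IsIsogenous W (A.quadraticTwist (d : ℚ)))
    (h4A : 2 ^ 2 ∣ A.conductorNorm ℤ) (hAN : A.conductorNorm ℤ ∣ N)
    {C : WeierstrassCurve ℚ} [C.IsElliptic] [C.IsGloballyMinimal] (u : VariableChange ℚ)
    (hu : u • A.quadraticTwist (d : ℚ) = C) (hΔ : C.Δ = (d : ℚ) ^ 6 * A.Δ) {p : ℤ}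
    (hp : ¬ p ∣ D'.maninConstant) : ¬ p ∣ D.maninConstant :=
  fun h ↦ hp (h.trans (maninLocalTwoThree_maninConstant_dvd_of_additiveTwist_two_aligned hnf D hopt
    h64 hd D' htw h4A hAN u hu hΔ))

end Summit.BirchSwinnertonDyer.BirchSwinnertonDyer.Theorems

end
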